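import Summits.Ventures.Crystal3D.Theorems.StickyWulffConstantTextureLiminfTexShadowBetaIIIAtBridge
import Summits.Ventures.Crystal3D.Theorems.StickyWulffConstantTextureLiminfTexShadowBothFccFirstDefs
import HarnessLib

/-!
# TexShadow v8 — the «BothFcc-FIRST» glue: `BilayerWallV5` from F-U, lane G's charge-`13/25` ledger `hG`, and the three FAULTED stubs
# (T-V5 PORT; lane T, crux `TextureLiminfV5`, stmt-Ventures-23912; cf-p1 DECISION (lxxxii), 2026-08-29T01:46:40Z)

HONEST FRAMING. Venture `Summits/Ventures/Crystal3D` (cell `crystal3d-full`), route `route-Ventures-StickyWulffConstant`, helper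
`--supports` the law-v5 crux `TextureLiminfV5` (stmt-Ventures-23912).  Pure bookkeeping (census-free, standard axioms); every wall input is
a HYPOTHESIS; rung F-C1 not moved.

THE CUT.  `by_cases BothFcc σ₁ σ₂` FIRST.  The `BothFcc` half of the wall law at cap `c₀` (`BilayerWallBothFccAt`, …BothFccFirstDefs) is
closed from {zero cell, F-U, hG} by `bilayerWallAt_of_bothFcc_ledgerWith` (…BetaIIIAtBridge p686715), hG = lane G's uniform charge-`c₀`
ledger over all affinely non-co-axial fcc pairs in EXACTLY the shape of 19480-p2's `genericWallFloorWithCharge_all_of_coverage` at fixed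
`(K, R₀)`.  The `BothFcc` half then LIFTS every faulted stub to the unrestricted cap-`c₀` way station the v5 glue (…AtGlueV5 p685539)
already consumes — no new `by_cases` tree is needed:
* `bothFccAt_of_ledgerWith`, `bothFccAt_of_withCharge` — the `BothFcc` half from F-U + hG (`TwoSlabLedgerWith` / `GenericWallFloorWithCharge`
  currency, the latter through `twoSlabLedgerWith_of_withCharge`);
* lifts `onReachCoaxialAt_of_bothFccAt`, `zigCoaxialAt_of_bothFccAt` (T-F2's two faulted classes ⇒ O3/ZO3 at cap `c₀`),
  `residualAt_of_bothFccAt` (faulted residual ⇒ residual at cap `c₀`), `deficitMinAt_of_bothFccAt` (faulted payer pool ⇒ Deficit-MIN at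
  cap `c₀`, `bilayerWallAt_of_payerBound` on the faulted branch);
* **`bilayerWallCharged_of_stubsBothFccFirst`** (every `0 ≤ c₀ ≤ 1`, `R₀ ≥ 10`) and the law-v5 instance under cf-p1's name
  **`bilayerWallV5_of_stubsBothFccFirst : E1-data → StarPairFar facts → 10 ≤ R₀ → (∃ C, CoaxialUnifAt C R₀) →
  (∃ K, ∀ P₁ t₁ P₂ t₂, ¬(affine coax) → GenericWallFloorWithCharge K R₀ (13/25) P₁ t₁ P₂ t₂) →
  ((∃ C, …FaultedOnReachCoaxialAt (13/25) C R₀) ∧ (∃ C, …FaultedZigCoaxialAt (13/25) C R₀)) → (∃ C, HStripPayerPoolFaultedAt (13/25) C R₀) →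
  (∃ C, BilayerWallResidualFaultedAt (13/25) C R₀) → BilayerWallV5`**.
E1-data / StarPairFar survive only for the FAULTED generic branch (walker-covered, row-covered, zig-frames-apart closers).  v8 stubs (cf-p1):
l12Local, barlowAdhesionR, E1, starPairFar, coaxialUnif, genericLedgerWith [= hG], famFaulted, hStripPayerPoolFaulted, residualFaulted,
textureBuild.
WHAT THIS IS NOT: no proof of F-U, of lane G's ledger, of T-F2, of the faulted pool or residual; F-C1 not moved.
-/

noncomputable section

namespace Summit.Ventures.Crystal3D.Cruxes.TextureLiminf.TexShadow

open Summit.Ventures.Crystal3D Summit.Ventures.Crystal3D.Theorems Finset TentCertificate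
open Literature.MathematicalPhysics.StatisticalMechanics (IsHaggSeq fccStacking barlowStacking basalMirror)
open scoped InnerProductSpace

/-! ## The `BothFcc` half from F-U and lane G's charge-`c₀` ledger -/

/-- **The `BothFcc` half at cap `c₀ ≤ 1`, `R₀ ≥ 3`, from F-U's matrix and lane G's ADHESION-form charge-`c₀` ledger** (explicit constant). -/
theorem bothFccAt_of_ledgerWith {c₀ K R₀ C_F : ℝ} (hc₀ : 0 ≤ c₀) (hc₁ : c₀ ≤ 1) (hR₀ : 3 ≤ R₀) (hFU : CoaxialUnifAt C_F R₀)
    (hG : ∀ (P₁ : E3 ≃ₗᵢ[ℝ] E3) (t₁ : E3) (P₂ : E3 ≃ₗᵢ[ℝ] E3) (t₂ : E3),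
      ¬ (∃ (L : E3 ≃ₗᵢ[ℝ] E3) (r₁ r₂ : E3) (σ σ' : ℤ → ℤ), IsHaggSeq σ ∧ IsHaggSeq σ' ∧
        (fun p => P₁ p + t₁) '' fccStacking 1 (Real.sqrt (2 / 3)) ⊆
          (fun p => L p + r₁) '' barlowStacking 1 (Real.sqrt (2 / 3)) σ ∧
        (fun p => P₂ p + t₂) '' fccStacking 1 (Real.sqrt (2 / 3)) ⊆
          (fun p => L p + r₂) '' barlowStacking 1 (Real.sqrt (2 / 3)) σ') →
      TwoSlabLedgerWith K R₀ c₀ P₁ t₁ P₂ t₂) :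
    BilayerWallBothFccAt c₀
      (max (max (C_F + 60 * Real.sqrt 2 * Real.pi) ((3456 + 1152 * (R₀ + 1)) / 2)) (K + 60 * Real.sqrt 2 * Real.pi)) R₀ :=
  fun _ _ hσ₁ hσ₂ hfcc L₁ L₂ s₁ s₂ _ _ _ _ hfr₁ hfr₂ _ _ hadm =>
    bilayerWallAt_of_bothFcc_ledgerWith hc₀ hc₁ hR₀ hFU hG hσ₁ hσ₂ hfcc L₁ L₂ s₁ s₂ hfr₁ hfr₂ hadm

/-- **The `BothFcc` half at cap `c₀ ≤ 1`, `R₀ ≥ 3`, from F-U (`∃ C, CoaxialUnifAt C R₀`) and lane G's DEFICIENCY-form charge-`c₀` ledger**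
(`∃ K, ∀ non-co-axial pairs, GenericWallFloorWithCharge K R₀ c₀` — the conclusion of `genericWallFloorWithCharge_all_of_coverage`). -/
theorem bothFccAt_of_withCharge {c₀ R₀ : ℝ} (hc₀ : 0 ≤ c₀) (hc₁ : c₀ ≤ 1) (hR₀ : 3 ≤ R₀) (hF : ∃ C : ℝ, CoaxialUnifAt C R₀)
    (hG : ∃ K : ℝ, ∀ (P₁ : E3 ≃ₗᵢ[ℝ] E3) (t₁ : E3) (P₂ : E3 ≃ₗᵢ[ℝ] E3) (t₂ : E3),
      ¬ (∃ (L : E3 ≃ₗᵢ[ℝ] E3) (r₁ r₂ : E3) (σ σ' : ℤ → ℤ), IsHaggSeq σ ∧ IsHaggSeq σ' ∧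
        (fun p => P₁ p + t₁) '' fccStacking 1 (Real.sqrt (2 / 3)) ⊆
          (fun p => L p + r₁) '' barlowStacking 1 (Real.sqrt (2 / 3)) σ ∧
        (fun p => P₂ p + t₂) '' fccStacking 1 (Real.sqrt (2 / 3)) ⊆
          (fun p => L p + r₂) '' barlowStacking 1 (Real.sqrt (2 / 3)) σ') →
      GenericWallFloorWithCharge K R₀ c₀ P₁ t₁ P₂ t₂) :
    ∃ C : ℝ, BilayerWallBothFccAt c₀ C R₀ := by
  obtain ⟨C_F, hFU⟩ := hF
  obtain ⟨K, hK⟩ := hG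
  obtain ⟨K', -, hconv⟩ := twoSlabLedgerWith_of_withCharge
  exact ⟨_, bothFccAt_of_ledgerWith hc₀ hc₁ hR₀ hFU fun P₁ t₁ P₂ t₂ hnc => hconv (by linarith) (hK P₁ t₁ P₂ t₂ hnc)⟩

/-! ## Lifts: the `BothFcc` half + a FAULTED stub ⇒ the unrestricted way station at cap `c₀` -/

/-- `BothFcc` half + T-F2's corner-keyed faulted class ⇒ O3 at cap `c₀` (unrestricted). -/
theorem onReachCoaxialAt_of_bothFccAt {c₀ R₀ C_B C_f : ℝ} (hR₀0 : 0 ≤ R₀) (hB : BilayerWallBothFccAt c₀ C_B R₀)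
    (hf : BilayerWallFaultedOnReachCoaxialAt c₀ C_f R₀) : BilayerWallOnReachCoaxialAt c₀ (max C_B C_f) R₀ := by
  intro σ₁ σ₂ hσ₁ hσ₂ L₁ L₂ s₁ s₂ A₁ A₂ u₁ u₂ hA₁ hA₂ hgen c m hadm hdom hcl
  by_cases hfcc : BothFcc σ₁ σ₂
  · exact bilayerWallAt_mono hR₀0 (le_max_left _ _) (hB σ₁ σ₂ hσ₁ hσ₂ hfcc L₁ L₂ s₁ s₂ A₁ A₂ u₁ u₂ hA₁ hA₂ c m hadm)
  · exact bilayerWallAt_mono hR₀0 (le_max_right _ _)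
      (hf σ₁ σ₂ hσ₁ hσ₂ hfcc L₁ L₂ s₁ s₂ A₁ A₂ u₁ u₂ hA₁ hA₂ hgen c m hadm hdom hcl)

/-- `BothFcc` half + T-F2's zig-keyed faulted class ⇒ ZO3 at cap `c₀` (unrestricted). -/
theorem zigCoaxialAt_of_bothFccAt {c₀ R₀ C_B C_f : ℝ} (hR₀0 : 0 ≤ R₀) (hB : BilayerWallBothFccAt c₀ C_B R₀)
    (hf : BilayerWallFaultedZigCoaxialAt c₀ C_f R₀) : BilayerWallZigCoaxialAt c₀ (max C_B C_f) R₀ := by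
  intro σ₁ σ₂ hσ₁ hσ₂ L₁ L₂ s₁ s₂ A₁ A₂ u₁ u₂ hA₁ hA₂ hgen c m hadm hΔ₁ hΔ₂ hfl hoff hrow hzg hcl
  by_cases hfcc : BothFcc σ₁ σ₂
  · exact bilayerWallAt_mono hR₀0 (le_max_left _ _) (hB σ₁ σ₂ hσ₁ hσ₂ hfcc L₁ L₂ s₁ s₂ A₁ A₂ u₁ u₂ hA₁ hA₂ c m hadm)
  · exact bilayerWallAt_mono hR₀0 (le_max_right _ _)
      (hf σ₁ σ₂ hσ₁ hσ₂ hfcc L₁ L₂ s₁ s₂ A₁ A₂ u₁ u₂ hA₁ hA₂ hgen c m hadm hΔ₁ hΔ₂ hfl hoff hrow hzg hcl)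

/-- `BothFcc` half + the faulted residual ⇒ the residual part at cap `c₀` (unrestricted). -/
theorem residualAt_of_bothFccAt {c₀ R₀ C_B C_r : ℝ} (hR₀0 : 0 ≤ R₀) (hB : BilayerWallBothFccAt c₀ C_B R₀)
    (hr : BilayerWallResidualFaultedAt c₀ C_r R₀) : BilayerWallResidualAt c₀ (max C_B C_r) R₀ := by
  intro σ₁ σ₂ hσ₁ hσ₂ L₁ L₂ s₁ s₂ A₁ A₂ u₁ u₂ hA₁ hA₂ hres c m hadm
  by_cases hfcc : BothFcc σ₁ σ₂
  · exact bilayerWallAt_mono hR₀0 (le_max_left _ _) (hB σ₁ σ₂ hσ₁ hσ₂ hfcc L₁ L₂ s₁ s₂ A₁ A₂ u₁ u₂ hA₁ hA₂ c m hadm)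
  · exact bilayerWallAt_mono hR₀0 (le_max_right _ _)
      (hr σ₁ σ₂ hσ₁ hσ₂ hfcc L₁ L₂ s₁ s₂ A₁ A₂ u₁ u₂ hA₁ hA₂ hres c m hadm)

/-- `BothFcc` half + the faulted payer pool ⇒ Deficit-MIN at cap `c₀` (unrestricted), `R₀ ≥ 3` (`bilayerWallAt_of_payerBound` on the faulted
branch). -/
theorem deficitMinAt_of_bothFccAt {c₀ R₀ C_B : ℝ} (hR3 : 3 ≤ R₀) (hB : BilayerWallBothFccAt c₀ C_B R₀)
    (hPool : ∃ C : ℝ, HStripPayerPoolFaultedAt c₀ C R₀) : ∃ C : ℝ, BilayerWallDeficitMinAt c₀ C R₀ := by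
  obtain ⟨C, hpool⟩ := hPool
  refine ⟨max C_B ((C + 3456 + 1152 * (R₀ + 1)) / 2), ?_⟩
  intro σ₁ σ₂ hσ₁ hσ₂ L₁ L₂ s₁ s₂ A₁ A₂ u₁ u₂ hA₁ hA₂ hgen c m hadm hZ hR₁ hR₂ hR₃' hR₄
  have hR₀0 : 0 ≤ R₀ := by linarith
  by_cases hfcc : BothFcc σ₁ σ₂
  · exact bilayerWallAt_mono hR₀0 (le_max_left _ _) (hB σ₁ σ₂ hσ₁ hσ₂ hfcc L₁ L₂ s₁ s₂ A₁ A₂ u₁ u₂ hA₁ hA₂ c m hadm)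
  · exact bilayerWallAt_mono hR₀0 (le_max_right _ _)
      (bilayerWallAt_of_payerBound hσ₁ hσ₂ L₁ L₂ s₁ s₂ R₀ C hR3 c
        (hpool σ₁ σ₂ hσ₁ hσ₂ hfcc L₁ L₂ s₁ s₂ A₁ A₂ u₁ u₂ hA₁ hA₂ hgen c m hadm hZ hR₁ hR₂ hR₃' hR₄))

/-! ## The composition -/

/-- **The wall law at cap `c₀` (`0 ≤ c₀ ≤ 1`, `R₀ ≥ 10`) from the v8 inputs**: E1-data + StarPairFar facts (for the faulted generic branch
only), F-U, lane G's uniform deficiency-form charge-`c₀` ledger, T-F2 at cap `c₀` (both keys), the faulted payer pool, the faulted residual. -/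
theorem bilayerWallCharged_of_stubsBothFccFirst
    {sE : E3} (hsE : sE ∈ fccSlots) (hcert : ExactOnly 0 (fccSlots.filter fun w => 0 < ⟪w, sE⟫_ℝ))
    (hDS : ∀ F₁ F₂ : E3 ≃ₗᵢ[ℝ] E3, DoubleStarCoaxialAt F₁ F₂) (hCP : CapPairCoaxial) {c₀ R₀ : ℝ} (hc₀ : 0 ≤ c₀) (hc₁ : c₀ ≤ 1)
    (h10 : 10 ≤ R₀) (hF : ∃ C : ℝ, CoaxialUnifAt C R₀)
    (hG : ∃ K : ℝ, ∀ (P₁ : E3 ≃ₗᵢ[ℝ] E3) (t₁ : E3) (P₂ : E3 ≃ₗᵢ[ℝ] E3) (t₂ : E3),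
      ¬ (∃ (L : E3 ≃ₗᵢ[ℝ] E3) (r₁ r₂ : E3) (σ σ' : ℤ → ℤ), IsHaggSeq σ ∧ IsHaggSeq σ' ∧
        (fun p => P₁ p + t₁) '' fccStacking 1 (Real.sqrt (2 / 3)) ⊆
          (fun p => L p + r₁) '' barlowStacking 1 (Real.sqrt (2 / 3)) σ ∧
        (fun p => P₂ p + t₂) '' fccStacking 1 (Real.sqrt (2 / 3)) ⊆
          (fun p => L p + r₂) '' barlowStacking 1 (Real.sqrt (2 / 3)) σ') →
      GenericWallFloorWithCharge K R₀ c₀ P₁ t₁ P₂ t₂)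
    (hFault : (∃ C : ℝ, BilayerWallFaultedOnReachCoaxialAt c₀ C R₀) ∧ (∃ C : ℝ, BilayerWallFaultedZigCoaxialAt c₀ C R₀))
    (hPool : ∃ C : ℝ, HStripPayerPoolFaultedAt c₀ C R₀) (hRes : ∃ C : ℝ, BilayerWallResidualFaultedAt c₀ C R₀) :
    BilayerWallCharged c₀ := by
  have hR₀6 : 6 ≤ R₀ := by linarith
  have hR₀0 : 0 ≤ R₀ := by linarith
  obtain ⟨C_B, hB⟩ := bothFccAt_of_withCharge hc₀ hc₁ (by linarith) hF hG
  obtain ⟨⟨C_f, hf⟩, ⟨C_z, hz⟩⟩ := hFault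
  have hO3 : ∃ C : ℝ, BilayerWallOnReachCoaxialAt c₀ C R₀ := ⟨_, onReachCoaxialAt_of_bothFccAt hR₀0 hB hf⟩
  have hZO3 : ∃ C : ℝ, BilayerWallZigCoaxialAt c₀ C R₀ := ⟨_, zigCoaxialAt_of_bothFccAt hR₀0 hB hz⟩
  obtain ⟨C_O, hO⟩ := onReachAllCharged_of_classesAt hsE hcert hDS hCP hc₁ hR₀6 hO3 hZO3
  obtain ⟨C_W, hW⟩ := bilayerWallWalkerCoveredAt_of_F4 hsE hcert hDS hCP hR₀6
  obtain ⟨C_R, hR⟩ := bilayerWallRowCovFrom_framesApart hsE hcert hDS hCP R₀ hR₀6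
  obtain ⟨C_D, hD⟩ := deficitMinAt_of_bothFccAt (by linarith) hB hPool
  obtain ⟨C_X, hX⟩ := hRes
  exact bilayerWallCharged_of_splitAt (by linarith) (genericAt_of_four_min hc₁ hR₀0 hW hR hO hD)
    (residualAt_of_bothFccAt hR₀0 hB hX)

/-- **`BilayerWallV5` from the TexShadow v8 inputs at one `R₀ ≥ 10`** (cf-p1 (lxxxii)): E1-data, the StarPairFar facts, F-U
(`∃ C, CoaxialUnifAt C R₀`), lane G's charge-`13/25` ledger `∃ K, ∀ P₁ t₁ P₂ t₂, ¬(affine coax) → GenericWallFloorWithCharge K R₀ (13/25) …`,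
T-F2 at `13/25` (both keys), the faulted h-strip payer pool at `13/25`, the faulted residual at `13/25`. -/
theorem bilayerWallV5_of_stubsBothFccFirst
    {sE : E3} (hsE : sE ∈ fccSlots) (hcert : ExactOnly 0 (fccSlots.filter fun w => 0 < ⟪w, sE⟫_ℝ))
    (hDS : ∀ F₁ F₂ : E3 ≃ₗᵢ[ℝ] E3, DoubleStarCoaxialAt F₁ F₂) (hCP : CapPairCoaxial) {R₀ : ℝ} (h10 : 10 ≤ R₀)
    (hF : ∃ C : ℝ, CoaxialUnifAt C R₀)
    (hG : ∃ K : ℝ, ∀ (P₁ : E3 ≃ₗᵢ[ℝ] E3) (t₁ : E3) (P₂ : E3 ≃ₗᵢ[ℝ] E3) (t₂ : E3),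
      ¬ (∃ (L : E3 ≃ₗᵢ[ℝ] E3) (r₁ r₂ : E3) (σ σ' : ℤ → ℤ), IsHaggSeq σ ∧ IsHaggSeq σ' ∧
        (fun p => P₁ p + t₁) '' fccStacking 1 (Real.sqrt (2 / 3)) ⊆
          (fun p => L p + r₁) '' barlowStacking 1 (Real.sqrt (2 / 3)) σ ∧
        (fun p => P₂ p + t₂) '' fccStacking 1 (Real.sqrt (2 / 3)) ⊆
          (fun p => L p + r₂) '' barlowStacking 1 (Real.sqrt (2 / 3)) σ') →
      GenericWallFloorWithCharge K R₀ (13 / 25) P₁ t₁ P₂ t₂)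
    (hFault : (∃ C : ℝ, BilayerWallFaultedOnReachCoaxialAt (13 / 25) C R₀) ∧
      (∃ C : ℝ, BilayerWallFaultedZigCoaxialAt (13 / 25) C R₀))
    (hPool : ∃ C : ℝ, HStripPayerPoolFaultedAt (13 / 25) C R₀) (hRes : ∃ C : ℝ, BilayerWallResidualFaultedAt (13 / 25) C R₀) :
    BilayerWallV5 :=
  bilayerWallCharged_of_stubsBothFccFirst hsE hcert hDS hCP (by norm_num) (by norm_num) h10 hF hG hFault hPool hRes

end Summit.Ventures.Crystal3D.Cruxes.TextureLiminf.TexShadow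

end
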